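import Literature.Topology.FourManifolds.MazurDoubleHolds
import HarnessLib

/-!
# Stub `stub_seamFloorMazur` of line `seam_rigidity` for crux `RootDecompAE.NonSeifertTwistedDoubleResidual`
(item stmt-SmoothPoincare4-32001, route route-SmoothPoincare4-RootDecompAE; decomp-sp4 LANDING LIST 3, row 3)

The FLOOR stub `stub_seamFloorMazur` of the registered skeleton
`Summits/SmoothPoincare4/SmoothPoincare4/Cruxes/NonSeifertTwistedDoubleResidual/Lines/seam_rigidity.lean` (skeleton 5869a095…,
lens decomp-sp4-lens-4; stub registered 2026-08-30) is, by that file's own docstring, VERBATIM the statement of the named fact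
`Literature.Topology.FourManifolds.Mazur1961_double_sphere_four` (`MazurDouble.lean`), which is PROVED in the tree by
`Literature.Topology.FourManifolds.Mazur1961_double_sphere_four_holds` (`MazurDoubleHolds.lean`: the counted thickening of the
double, the rearranged nice Morse function, Milnor's first cancellation theorem for the `(1, 2)` pair in cancelling position,
the disc theorem, `∂D⁵ = S⁴`).  It was registered as a stub ONLY because `MazurDouble(Holds)` had no olean on the check-farm
snapshot the skeleton had to elaborate against; this file closes it by name (`Mazur1961_double_sphere_four` unfolds to the
stub's statement, so the tree theorem is accepted by definitional unfolding — no new mathematics, no new definitions).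

Mathematical content (Mazur 1961; Aitchison–Rubinstein 1984, Lemma 5.4): if `W` is a compact contractible `4`-manifold
with a handle decomposition into one `0`-, one `1`- and one `2`-handle (a Mazur-type manifold), then every smooth closed
`4`-manifold `P` that is a double `W ∪_{id} W̄` of `W` is diffeomorphic to `S⁴`.

Rung currency: rung 0 — a bookkeeping/floor edge of the decomposition cell decomp-sp4 (first stub credit on line
`seam_rigidity`: 1 of 4 stubs; the load-bearing stubs `stub_seamFiniteMod`, `stub_seamInfiniteMod` and the tail
`stub_seamTail` stay open).  The same statement is the floor stub `stub_mazurDouble` of line `mazur_seams`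
(stmt-SmoothPoincare4-32000), closed in the sibling file `RootDecompAESeifertTwistedDoublesStandardStubMazurDouble.lean`.
Nothing here proves `SmoothPoincare4`.

References: B. Mazur, *A note on some contractible 4-manifolds*, Ann. of Math. 73 (1961) 221–228, Theorem and Cor. 1
[Mazur1961]; I. R. Aitchison, J. H. Rubinstein, *Fibered knots and involutions on homotopy spheres*, Contemp. Math. 35
(1984), Lemma 5.4 [AitchisonRubinstein1984]; J. Milnor, *Lectures on the h-cobordism theorem* (1965), Thms. 3.4, 5.4
[MilnorHCobordism1965].
-/

-- D-0017 layout `Summit.<Summit>.<Problem>…` repeats the summit name for single-problem summits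
set_option linter.dupNamespace false

open scoped Manifold ContDiff Topology
open Set Function Literature.Topology.FourManifolds

namespace Summit.SmoothPoincare4.SmoothPoincare4.Theorems.NonSeifertTwistedDoubleResidual.SeamRigidity

/-- **Registered stub `stub_seamFloorMazur` of line `seam_rigidity` (crux `RootDecompAE.NonSeifertTwistedDoubleResidual`,
stmt-SmoothPoincare4-32001), CLOSED BY NAME**: the double of a Mazur-type compact contractible `4`-manifold (one `0`-, one
`1`-, one `2`-handle) is diffeomorphic to `S⁴` — the tree theorem
`Literature.Topology.FourManifolds.Mazur1961_double_sphere_four_holds`, whose statement `Mazur1961_double_sphere_four`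
unfolds to this one verbatim. [cite: Mazur1961, Theorem and Corollary 1] [cite: AitchisonRubinstein1984, Lemma 5.4] -/
theorem stub_seamFloorMazur :
  ∀ (W : Type) [TopologicalSpace W] [T2Space W] [SecondCountableTopology W]
    [ChartedSpace (EuclideanHalfSpace 4) W] [IsManifold (𝓡∂ 4) ∞ W] [CompactSpace W]
    [ContractibleSpace W],
    HasHandleDecomposition 3 W (fun k => if k ≤ 2 then 1 else 0) →
    ∀ (b : BoundaryData (𝓡∂ 4) W (𝓡 3))
      (P : Type) [TopologicalSpace P] [T2Space P] [SecondCountableTopology P]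
      [ChartedSpace (EuclideanSpace ℝ (Fin 4)) P] [IsManifold (𝓡 4) ∞ P],
    IsDouble b (𝓡 4) P → Nonempty (P ≃ₘ⟮𝓡 4, 𝓡 4⟯ Metric.sphere (0 : EuclideanSpace ℝ (Fin 5)) 1) :=
  Mazur1961_double_sphere_four_holds

end Summit.SmoothPoincare4.SmoothPoincare4.Theorems.NonSeifertTwistedDoubleResidual.SeamRigidity
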